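import Summits.QuantumFields.QCD.Theorems.HeatSlicedQuarksSmallFieldUltracontractivityFixedPointD3b
import Summits.QuantumFields.QCD.Theorems.HeatSlicedQuarksSmallFieldUltracontractivityStubFreeRowBounds
import Summits.QuantumFields.QCD.Theorems.HeatSlicedQuarksSmallFieldUltracontractivityStubCommutatorBound

/-!
# Caloric fixed point — part E: the `sSup` fixed point and `stub_caloricBootstrap`
(line lead, crux `SmallFieldUltracontractivity`, item stmt-QuantumFields-8871, line `point-centred-axial-parabolic`)

**The registered stub `stub_caloricBootstrap : FreeKernelDecay → LocalSupBound`** (the research content of the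
line).  `caloric_core` runs the bootstrap: the admissible family is parametrised by the TIME `s`
(`m ∈ [-1/2,1]`, `1 ≤ s`, `1024⌈√s⌉ ≤ L`, links within `torusDist ≤ 128⌈√s⌉` of the centre have deficit
`≤ 8κ²/s`), `B(S) = sSup { s‖row(e^{-sH_U})‖₂ : admissible, s ≤ S } ≤ S` (rows of the heat semigroup have norm
`≤ 1`); the main step (`stub_mainStep`, with the hereditary hypothesis supplied by `B(S)` itself at the time
`s/8`, sub-balls being admissible: `2⌈√(s/8)⌉ ≤ ⌈√s⌉`) gives `B(S) ≤ max(4096, C₀ + C₁κB(S))`, and the choice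
`κ = 1/(2C₁+2)` closes the fixed point `B(S) ≤ max(4096, 2C₀)` uniformly in `S`.  The conversion to the
`ℓ`-form of `LocalSupBound` uses admissibility for `s ≤ ℓ²/2²⁰`, the monotonicity of heat rows
(`stub_heatRowCalculus` (2)) for `ℓ²/2²⁰ < s ≤ ℓ²`, and the trivial bound for `s < 2²⁰`.  The free inputs are
`stub_freeRowBounds` and `stub_commutatorBound` applied to the hypothesis `FreeKernelDecay`.
-/
noncomputable section

namespace Summit.QuantumFields.QCD.Cruxes.SmallFieldUltracontractivity.PointCentredAxialParabolic

open Literature.MathematicalPhysics.QuantumLattice Literature.MathematicalPhysics.QuantumFieldTheory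
open Literature.Probability.LatticeModels (TorusSite)
open Summit.QuantumFields.QCD.Theorems.SmallFieldUltracontractivity.Negative
open scoped Matrix ComplexConjugate

/-- Rows of the heat kernel of `AᴴA` have `ℓ²` norm at most one (from the contraction on row vectors). -/
theorem rowSq_heat_le_one
    (hContr : ∀ (ι : Type) [Fintype ι] [DecidableEq ι] (A : Matrix ι ι ℂ) (w : ι → ℂ) (τ : ℝ), 0 ≤ τ →
      ∑ j, ‖∑ i, w i * (NormedSpace.exp (-(τ : ℂ) • (Aᴴ * A))) i j‖ ^ 2 ≤ ∑ i, ‖w i‖ ^ 2)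
    {κ : Type} [Fintype κ] [DecidableEq κ] (A : Matrix κ κ ℂ) (i : κ) {τ : ℝ} (hτ : 0 ≤ τ) :
    ∑ j, ‖(NormedSpace.exp (-(τ : ℂ) • (Aᴴ * A))) i j‖ ^ 2 ≤ 1 := by
  have h := hContr κ A (Pi.single i 1) τ hτ
  have hrow : ∀ j, ∑ i', (Pi.single i (1:ℂ) : κ → ℂ) i' * (NormedSpace.exp (-(τ : ℂ) • (Aᴴ * A))) i' j =
      (NormedSpace.exp (-(τ : ℂ) • (Aᴴ * A))) i j := by
    intro j
    rw [Finset.sum_eq_single i]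
    · simp
    · intro i' _ hi'; simp [hi']
    · simp
  have hone : ∑ i', ‖(Pi.single i (1:ℂ) : κ → ℂ) i'‖ ^ 2 = 1 := by
    rw [Finset.sum_eq_single i]
    · simp
    · intro i' _ hi'; simp [hi']
    · simp
  simp only [hrow] at h
  rwa [hone] at h

/-- Ceiling bookkeeping between the scales `s` and `s/8`: `2⌈√(s/8)⌉ ≤ ⌈√s⌉` for `s ≥ 4096`. -/
theorem two_mul_ceil_sqrt_div_eight_le {s : ℝ} (hs : (4096 : ℝ) ≤ s) :
    2 * ⌈Real.sqrt (s / 8)⌉₊ ≤ ⌈Real.sqrt s⌉₊ := by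
  have hs0 : 0 ≤ s := by linarith
  have hrs : 64 ≤ Real.sqrt s := by
    rw [show (64 : ℝ) = Real.sqrt (64 ^ 2) by rw [Real.sqrt_sq (by norm_num)]]
    exact Real.sqrt_le_sqrt (by norm_num; linarith)
  have h1 : Real.sqrt (s / 8) ≤ 2 / 5 * Real.sqrt s := by
    rw [show 2 / 5 * Real.sqrt s = Real.sqrt ((2 / 5) ^ 2 * s) by
      rw [Real.sqrt_mul (sq_nonneg _), Real.sqrt_sq (by norm_num)]]
    exact Real.sqrt_le_sqrt (by nlinarith)
  have h2 : ((⌈Real.sqrt (s / 8)⌉₊ : ℕ) : ℝ) < Real.sqrt (s / 8) + 1 := Nat.ceil_lt_add_one (Real.sqrt_nonneg _)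
  have h3 : Real.sqrt s ≤ ((⌈Real.sqrt s⌉₊ : ℕ) : ℝ) := Nat.le_ceil _
  have h4 : ((2 * ⌈Real.sqrt (s / 8)⌉₊ : ℕ) : ℝ) < ((⌈Real.sqrt s⌉₊ : ℕ) : ℝ) := by
    push_cast; nlinarith
  have : 2 * ⌈Real.sqrt (s / 8)⌉₊ < ⌈Real.sqrt s⌉₊ := by exact_mod_cast h4
  omega

/-- Scale bookkeeping of the conversion: for `1 ≤ s ≤ ℓ²/2²⁰` and `4ℓ < L`:
`1024 ≤ ℓ`, `1024⌈√s⌉ ≤ L` and `128⌈√s⌉ ≤ 2ℓ`. -/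
theorem scales_of_small_time {s : ℝ} {ℓ L : ℕ} (hs1 : 1 ≤ s) (hsl : s ≤ (ℓ : ℝ) ^ 2 / 2 ^ 20) (hL : 4 * ℓ < L) :
    1024 ≤ ℓ ∧ 1024 * ⌈Real.sqrt s⌉₊ ≤ L ∧ 128 * ⌈Real.sqrt s⌉₊ ≤ 2 * ℓ := by
  have hl0 : (0 : ℝ) ≤ ℓ := Nat.cast_nonneg ℓ
  have hl2 : (2 : ℝ) ^ 20 ≤ (ℓ : ℝ) ^ 2 := by
    have : (1 : ℝ) ≤ (ℓ : ℝ) ^ 2 / 2 ^ 20 := hs1.trans hsl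
    rw [le_div_iff₀ (by positivity)] at this
    linarith
  have hl : (1024 : ℝ) ≤ ℓ := by nlinarith
  have hlN : 1024 ≤ ℓ := by exact_mod_cast hl
  have hsqrt : Real.sqrt s ≤ (ℓ : ℝ) / 1024 := by
    rw [show (ℓ : ℝ) / 1024 = Real.sqrt (((ℓ : ℝ) / 1024) ^ 2) by rw [Real.sqrt_sq (by positivity)]]
    exact Real.sqrt_le_sqrt (by rw [div_pow]; norm_num; linarith)
  have hceil : ((⌈Real.sqrt s⌉₊ : ℕ) : ℝ) < Real.sqrt s + 1 := Nat.ceil_lt_add_one (Real.sqrt_nonneg _)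
  have hc : ((⌈Real.sqrt s⌉₊ : ℕ) : ℝ) < (ℓ : ℝ) / 1024 + 1 := by linarith
  have hA : ((1024 * ⌈Real.sqrt s⌉₊ : ℕ) : ℝ) < ((L : ℕ) : ℝ) := by
    have hL' : ((4 * ℓ : ℕ) : ℝ) < ((L : ℕ) : ℝ) := by exact_mod_cast hL
    push_cast at hL' ⊢
    nlinarith
  have hB : ((128 * ⌈Real.sqrt s⌉₊ : ℕ) : ℝ) < ((2 * ℓ : ℕ) : ℝ) := by
    push_cast; nlinarith
  have hA' : 1024 * ⌈Real.sqrt s⌉₊ < L := by exact_mod_cast hA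
  have hB' : 128 * ⌈Real.sqrt s⌉₊ < 2 * ℓ := by exact_mod_cast hB
  exact ⟨hlN, hA'.le, hB'.le⟩

/-- **The caloric fixed point (core)**: from the main step, the heat-row calculus, the free row bounds and
the commutator bound to `LocalSupBound`. -/
theorem caloric_core
    (hMain : ∀ {Cr cr : ℝ} (hcr : 0 < cr) (hCr : 0 ≤ Cr) (hFR : ∀ (L : ℕ) [NeZero L] (m : ℝ), m ∈ Set.Icc (-(1 / 2 : ℝ)) 1 → ∀ σ : ℝ, 0 ≤ σ → σ ≤ (L : ℝ) ^ 2 → ∀ (x : TorusSite 4 L) (a : Fin 3) (α : Fin 4), (∑ j, ‖(NormedSpace.exp (-(σ : ℂ) • ((wilsonDirac (fundamentalRep (Fin 3)) (freeCfg L) m 1)ᴴ * wilsonDirac (fundamentalRep (Fin 3)) (freeCfg L) m 1))) (x, a, α) j‖ ^ 2 ≤ (Cr / (1 + σ)) ^ 2) ∧ (∑ j, ‖(NormedSpace.exp (-(σ : ℂ) • ((wilsonDirac (fundamentalRep (Fin 3)) (freeCfg L) m 1)ᴴ * wilsonDirac (fundamentalRep (Fin 3)) (freeCfg L) m 1)))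 (x, a, α) j‖ ≤ Cr * Real.exp (-(cr * σ * m ^ 2))) ∧ ∀ μ : Fin 4, ∑ z : TorusSite 4 L, ∑ b : Fin 3, ∑ β : Fin 4, ‖(NormedSpace.exp (-(σ : ℂ) • ((wilsonDirac (fundamentalRep (Fin 3)) (freeCfg L) m 1)ᴴ * wilsonDirac (fundamentalRep (Fin 3)) (freeCfg L) m 1))) (x, a, α) (z, b, β) - (NormedSpace.exp (-(σ : ℂ) • ((wilsonDirac (fundamentalRep (Fin 3)) (freeCfg L) m 1)ᴴ * wilsonDirac (fundamentalRep (Fin 3)) (freeCfg L) m 1))) (x, a, α) (Site.shift z μ, b, β)‖ ≤ Cr * Real.exp (-(cr * σ * m ^ 2)) / Real.sqrt (1 + σ)) {Cc : ℝ} (hCc : 0 ≤ Cc) (hComm : ∀ (L : ℕ) [NeZero L] (m : ℝ), m ∈ Set.Icc (-(1 / 2 : ℝ)) 1 → ∀ σ : ℝ, 0 ≤ σ → σ ≤ (L : ℝ) ^ 2 → ∀ (x : TorusSite 4 L) (a : Fin 3) (α : Fin 4) (N : ℕ), 8 ≤ N → 4 * N + 8 ≤ L → ∑ j, ‖(NormedSpace.exp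 (-(σ : ℂ) • ((wilsonDirac (fundamentalRep (Fin 3)) (freeCfg L) m 1)ᴴ * wilsonDirac (fundamentalRep (Fin 3)) (freeCfg L) m 1)) * (((wilsonDirac (fundamentalRep (Fin 3)) (freeCfg L) m 1)ᴴ * wilsonDirac (fundamentalRep (Fin 3)) (freeCfg L) m 1) * Matrix.diagonal (fun j : TorusSite 4 L × Fin 3 × Fin 4 => (((∏ ν : Fin 4, (max 0 (1 - (max 0 ((min ((j.1 - x) ν).val (L - ((j.1 - x) ν).val) : ℝ) / (N : ℝ) - 1)) ^ 2)) ^ 2) : ℝ) : ℂ)) - Matrix.diagonal (fun j : TorusSite 4 L × Fin 3 × Fin 4 => (((∏ ν : Fin 4, (max 0 (1 - (max 0 ((min ((j.1 - x) ν).val (L - ((j.1 - x) ν).val) : ℝ) / (N : ℝ) - 1)) ^ 2)) ^ 2) : ℝ) : ℂ)) * ((wilsonDirac (fundamentalRep (Fin 3)) (freeCfg L) m 1)ᴴ * wilsonDirac (fundamentalRep (Fin 3)) (freeCfg L) m 1))) (x, a, α) j‖ ^ 2 ≤ (Cc / (N : ℝ) ^ 4) ^ 2) {L : ℕ} [NeZero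 L] (U : GaugeConfig 4 L SU3) {m : ℝ} (hm : m ∈ Set.Icc (-(1 / 2 : ℝ)) 1) (x : TorusSite 4 L) (a : Fin 3) (α : Fin 4) {s κ B : ℝ} (hκ : 0 < κ) (hB : 0 ≤ B) (hs : (4096 : ℝ) ≤ s) (hL : 1024 * ⌈Real.sqrt s⌉₊ ≤ L) (hflat : ∀ z : TorusSite 4 L, torusDist x z ≤ 128 * ⌈Real.sqrt s⌉₊ → ∀ μ : Fin 4, 3 - ((fundamentalRep (Fin 3)) (U (z, μ))).trace.re ≤ 8 * κ ^ 2 / s) (hher : ∀ (z : TorusSite 4 L) (b : Fin 3) (β : Fin 4), torusDist x z ≤ 64 * ⌈Real.sqrt s⌉₊ → Real.sqrt (∑ j, ‖(NormedSpace.exp (-((s / 8 : ℝ) : ℂ) • ((wilsonDirac (fundamentalRep (Fin 3)) U m 1)ᴴ * wilsonDirac (fundamentalRep (Fin 3)) U m 1))) (z, b, β) j‖ ^ 2) ≤ 8 * B / s), s * Real.sqrt (∑ j, ‖(NormedSpace.exp (-(s : ℂ) • ((wilsonDirac (fundamentalRep (Fin 3)) U m 1)ᴴ * wilsonDirac (fundamentalRep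 (Fin 3)) U m 1))) (x, a, α) j‖ ^ 2) ≤ 3 * Cr + 3072 * Cc + 3072 * Cr * (1 / Real.sqrt cr + 3138) * (κ * B))
    (hRow : (∀ (ι : Type) [Fintype ι] [DecidableEq ι] (A : Matrix ι ι ℂ) (w : ι → ℂ) (τ : ℝ), 0 ≤ τ →
        ∑ j, ‖∑ i, w i * (NormedSpace.exp (-(τ : ℂ) • (Aᴴ * A))) i j‖ ^ 2 ≤ ∑ i, ‖w i‖ ^ 2) ∧
      (∀ (ι : Type) [Fintype ι] [DecidableEq ι] (A : Matrix ι ι ℂ) (i : ι) (τ' τ : ℝ), 0 ≤ τ' → τ' ≤ τ →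
        ∑ j, ‖(NormedSpace.exp (-(τ : ℂ) • (Aᴴ * A))) i j‖ ^ 2 ≤
          ∑ j, ‖(NormedSpace.exp (-(τ' : ℂ) • (Aᴴ * A))) i j‖ ^ 2) ∧
      (∀ (ι : Type) [Fintype ι] [DecidableEq ι] (A Γ : Matrix ι ι ℂ), Γ * A * Γ = Aᴴ → Γ * Γ = 1 →
        (∀ i j, i ≠ j → Γ i j = 0) → (∀ i, ‖Γ i i‖ = 1) → ∀ (i : ι) (τ : ℝ), 0 < τ →
        ∑ j, ‖(A * NormedSpace.exp (-(τ : ℂ) • (Aᴴ * A))) i j‖ ^ 2 ≤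
          1 / (Real.exp 1 * τ) * ∑ j, ‖(NormedSpace.exp (-((τ / 2 : ℝ) : ℂ) • (Aᴴ * A))) i j‖ ^ 2))
    (hFRx : ∃ C c : ℝ, 0 < c ∧ ∀ (L : ℕ) [NeZero L] (m : ℝ), m ∈ Set.Icc (-(1 / 2 : ℝ)) 1 →
      ∀ σ : ℝ, 0 ≤ σ → σ ≤ (L : ℝ) ^ 2 → ∀ (x : TorusSite 4 L) (a : Fin 3) (α : Fin 4),
        (∑ j, ‖(NormedSpace.exp (-(σ : ℂ) •
            ((wilsonDirac (fundamentalRep (Fin 3)) (freeCfg L) m 1)ᴴ *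
              wilsonDirac (fundamentalRep (Fin 3)) (freeCfg L) m 1))) (x, a, α) j‖ ^ 2 ≤ (C / (1 + σ)) ^ 2) ∧
        (∑ j, ‖(NormedSpace.exp (-(σ : ℂ) •
            ((wilsonDirac (fundamentalRep (Fin 3)) (freeCfg L) m 1)ᴴ *
              wilsonDirac (fundamentalRep (Fin 3)) (freeCfg L) m 1))) (x, a, α) j‖
          ≤ C * Real.exp (-(c * σ * m ^ 2))) ∧
        ∀ μ : Fin 4, ∑ z : TorusSite 4 L, ∑ b : Fin 3, ∑ β : Fin 4,
          ‖(NormedSpace.exp (-(σ : ℂ) •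
              ((wilsonDirac (fundamentalRep (Fin 3)) (freeCfg L) m 1)ᴴ *
                wilsonDirac (fundamentalRep (Fin 3)) (freeCfg L) m 1))) (x, a, α) (z, b, β) -
            (NormedSpace.exp (-(σ : ℂ) •
              ((wilsonDirac (fundamentalRep (Fin 3)) (freeCfg L) m 1)ᴴ *
                wilsonDirac (fundamentalRep (Fin 3)) (freeCfg L) m 1))) (x, a, α) (Site.shift z μ, b, β)‖
          ≤ C * Real.exp (-(c * σ * m ^ 2)) / Real.sqrt (1 + σ))
    (hCommx : ∃ C : ℝ, ∀ (L : ℕ) [NeZero L] (m : ℝ), m ∈ Set.Icc (-(1 / 2 : ℝ)) 1 →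
      ∀ σ : ℝ, 0 ≤ σ → σ ≤ (L : ℝ) ^ 2 → ∀ (x : TorusSite 4 L) (a : Fin 3) (α : Fin 4) (N : ℕ),
        8 ≤ N → 4 * N + 8 ≤ L →
        ∑ j, ‖(NormedSpace.exp (-(σ : ℂ) •
              ((wilsonDirac (fundamentalRep (Fin 3)) (freeCfg L) m 1)ᴴ *
                wilsonDirac (fundamentalRep (Fin 3)) (freeCfg L) m 1)) *
            (((wilsonDirac (fundamentalRep (Fin 3)) (freeCfg L) m 1)ᴴ *
                wilsonDirac (fundamentalRep (Fin 3)) (freeCfg L) m 1) *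
              Matrix.diagonal (fun j : TorusSite 4 L × Fin 3 × Fin 4 => (((∏ ν : Fin 4, (max 0 (1 - (max 0 ((min ((j.1 - x) ν).val (L - ((j.1 - x) ν).val) : ℝ) / (N : ℝ) - 1)) ^ 2)) ^ 2) : ℝ) : ℂ)) -
             Matrix.diagonal (fun j : TorusSite 4 L × Fin 3 × Fin 4 => (((∏ ν : Fin 4, (max 0 (1 - (max 0 ((min ((j.1 - x) ν).val (L - ((j.1 - x) ν).val) : ℝ) / (N : ℝ) - 1)) ^ 2)) ^ 2) : ℝ) : ℂ)) *
              ((wilsonDirac (fundamentalRep (Fin 3)) (freeCfg L) m 1)ᴴ *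
                wilsonDirac (fundamentalRep (Fin 3)) (freeCfg L) m 1))) (x, a, α) j‖ ^ 2 ≤
          (C / (N : ℝ) ^ 4) ^ 2) :
    ∃ κ : ℝ, 0 < κ ∧ ∃ C : ℝ, ∀ (L : ℕ) [NeZero L] (U : GaugeConfig 4 L SU3) (m : ℝ),
      m ∈ Set.Icc (-(1 / 2 : ℝ)) 1 → ∀ (x : TorusSite 4 L) (ℓ : ℕ), 1 ≤ ℓ → 4 * ℓ < L →
      (∀ z : TorusSite 4 L, torusDist x z ≤ 2 * ℓ →
        (∀ μ : Fin 4, 3 - ((fundamentalRep (Fin 3)) (U (z, μ))).trace.re ≤ (κ / (ℓ : ℝ)) ^ 2) ∧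
        (∀ μ ν : Fin 4, 3 - ((fundamentalRep (Fin 3)) (plaquetteHolonomy U z μ ν)).trace.re
          ≤ (κ / (ℓ : ℝ) ^ 2) ^ 2)) →
      ∀ s : ℝ, 1 ≤ s → s ≤ (ℓ : ℝ) ^ 2 → ∀ (a : Fin 3) (α : Fin 4),
        ∑ j, ‖(NormedSpace.exp (-(s : ℂ) •
            ((wilsonDirac (fundamentalRep (Fin 3)) U m 1)ᴴ * wilsonDirac (fundamentalRep (Fin 3)) U m 1)))
          (x, a, α) j‖ ^ 2 ≤ (C / s) ^ 2 := by
  classical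
  obtain ⟨hContr, hMono, -⟩ := hRow
  obtain ⟨Cr, cr, hcr, hFR⟩ := hFRx
  obtain ⟨Cc, hComm⟩ := hCommx
  /- ───── signs of the constants ───── -/
  have hCr : 0 ≤ Cr := by
    have h := (hFR 1 0 (by norm_num) 0 le_rfl (by positivity) (fun _ => 0) 0 0).2.1
    simp only [Complex.ofReal_zero, neg_zero, zero_smul, NormedSpace.exp_zero, mul_zero, zero_mul,
      Real.exp_zero, mul_one] at h
    refine le_trans (Finset.sum_nonneg fun _ _ => norm_nonneg _) h
  have hComm' : ∀ (L : ℕ) [NeZero L] (m : ℝ), m ∈ Set.Icc (-(1 / 2 : ℝ)) 1 → ∀ σ : ℝ, 0 ≤ σ → σ ≤ (L : ℝ) ^ 2 →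
      ∀ (x : TorusSite 4 L) (a : Fin 3) (α : Fin 4) (N : ℕ), 8 ≤ N → 4 * N + 8 ≤ L →
      ∑ j, ‖(NormedSpace.exp (-(σ : ℂ) • ((wilsonDirac (fundamentalRep (Fin 3)) (freeCfg L) m 1)ᴴ *
          wilsonDirac (fundamentalRep (Fin 3)) (freeCfg L) m 1)) *
        (((wilsonDirac (fundamentalRep (Fin 3)) (freeCfg L) m 1)ᴴ * wilsonDirac (fundamentalRep (Fin 3)) (freeCfg L) m 1) *
          Matrix.diagonal (fun j : TorusSite 4 L × Fin 3 × Fin 4 => (((∏ ν : Fin 4, (max 0 (1 - (max 0 ((min ((j.1 - x) ν).val (L - ((j.1 - x) ν).val) : ℝ) / (N : ℝ) - 1)) ^ 2)) ^ 2) : ℝ) : ℂ)) -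
         Matrix.diagonal (fun j : TorusSite 4 L × Fin 3 × Fin 4 => (((∏ ν : Fin 4, (max 0 (1 - (max 0 ((min ((j.1 - x) ν).val (L - ((j.1 - x) ν).val) : ℝ) / (N : ℝ) - 1)) ^ 2)) ^ 2) : ℝ) : ℂ)) *
          ((wilsonDirac (fundamentalRep (Fin 3)) (freeCfg L) m 1)ᴴ * wilsonDirac (fundamentalRep (Fin 3)) (freeCfg L) m 1))) (x, a, α) j‖ ^ 2 ≤
        (|Cc| / (N : ℝ) ^ 4) ^ 2 := by
    intro L _ m hm σ hσ hσL x a α N hN hNL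
    rw [show (|Cc| / (N : ℝ) ^ 4) ^ 2 = (Cc / (N : ℝ) ^ 4) ^ 2 by rw [div_pow, div_pow, sq_abs]]
    exact hComm L m hm σ hσ hσL x a α N hN hNL
  /- ───── the constants ───── -/
  set C₀ : ℝ := 3 * Cr + 3072 * |Cc| with hC₀
  set C₁ : ℝ := 3072 * Cr * (1 / Real.sqrt cr + 3138) with hC₁
  have hC₀0 : 0 ≤ C₀ := by positivity
  have hC₁0 : 0 ≤ C₁ := by positivity
  set κ : ℝ := 1 / (2 * C₁ + 2) with hκ
  have hκ0 : 0 < κ := by positivity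
  have hκC : C₁ * κ ≤ 1 / 2 := by
    rw [hκ, mul_one_div, div_le_iff₀ (by positivity)]; linarith
  set Bstar : ℝ := max 4096 (2 * C₀) with hBstar
  have hBstar0 : 0 ≤ Bstar := le_trans (by norm_num) (le_max_left _ _)
  /- ───── the admissible family, parametrised by the time, and its sup ───── -/
  set 𝒜 : ℝ → Set ℝ := fun S => {r | ∃ (L : ℕ) (_ : NeZero L) (U : GaugeConfig 4 L SU3) (m : ℝ) (x : TorusSite 4 L)
      (a : Fin 3) (α : Fin 4) (s : ℝ), m ∈ Set.Icc (-(1 / 2 : ℝ)) 1 ∧ 1 ≤ s ∧ s ≤ S ∧ 1024 * ⌈Real.sqrt s⌉₊ ≤ L ∧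
      (∀ z : TorusSite 4 L, torusDist x z ≤ 128 * ⌈Real.sqrt s⌉₊ → ∀ μ : Fin 4,
        3 - ((fundamentalRep (Fin 3)) (U (z, μ))).trace.re ≤ 8 * κ ^ 2 / s) ∧
      r = s * Real.sqrt (∑ j, ‖(NormedSpace.exp (-(s : ℂ) • ((wilsonDirac (fundamentalRep (Fin 3)) U m 1)ᴴ *
        wilsonDirac (fundamentalRep (Fin 3)) U m 1))) (x, a, α) j‖ ^ 2)} with h𝒜
  -- elements are bounded by `S`
  have hle : ∀ S, ∀ r ∈ 𝒜 S, 0 ≤ r ∧ r ≤ S := by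
    intro S r hr
    rw [h𝒜] at hr
    obtain ⟨L, hL, U, m, x, a, α, s, hm, hs1, hsS, -, -, rfl⟩ := hr
    have hrow := rowSq_heat_le_one hContr (wilsonDirac (fundamentalRep (Fin 3)) U m 1) (x, a, α) (by linarith : (0:ℝ) ≤ s)
    have hsq1 : Real.sqrt (∑ j, ‖(NormedSpace.exp (-(s : ℂ) • ((wilsonDirac (fundamentalRep (Fin 3)) U m 1)ᴴ *
        wilsonDirac (fundamentalRep (Fin 3)) U m 1))) (x, a, α) j‖ ^ 2) ≤ 1 := Real.sqrt_le_one.mpr hrow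
    have hsq0 := Real.sqrt_nonneg (∑ j, ‖(NormedSpace.exp (-(s : ℂ) • ((wilsonDirac (fundamentalRep (Fin 3)) U m 1)ᴴ *
        wilsonDirac (fundamentalRep (Fin 3)) U m 1))) (x, a, α) j‖ ^ 2)
    exact ⟨by positivity, by nlinarith⟩
  have hbdd : ∀ S, BddAbove (𝒜 S) := fun S => ⟨S, fun r hr => (hle S r hr).2⟩
  have hsup0 : ∀ S, 0 ≤ sSup (𝒜 S) := fun S => Real.sSup_nonneg fun r hr => (hle S r hr).1
  /- ───── the main inequality for each admissible datum ───── -/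
  have hkey : ∀ S, ∀ r ∈ 𝒜 S, r ≤ max 4096 (C₀ + C₁ * κ * sSup (𝒜 S)) := by
    intro S r hr
    have hr' := hr
    rw [h𝒜] at hr
    obtain ⟨L, hL, U, m, x, a, α, s, hm, hs1, hsS, hLs, hflat, rfl⟩ := hr
    by_cases hs : s < 4096
    · have h := rowSq_heat_le_one hContr (wilsonDirac (fundamentalRep (Fin 3)) U m 1) (x, a, α) (by linarith : (0:ℝ) ≤ s)
      have hsq1 := Real.sqrt_le_one.mpr h
      have hsq0 := Real.sqrt_nonneg (∑ j, ‖(NormedSpace.exp (-(s : ℂ) • ((wilsonDirac (fundamentalRep (Fin 3)) U m 1)ᴴ *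
          wilsonDirac (fundamentalRep (Fin 3)) U m 1))) (x, a, α) j‖ ^ 2)
      refine le_trans ?_ (le_max_left _ _)
      nlinarith
    · push Not at hs
      haveI := hL
      -- the hereditary hypothesis at time `s/8`
      have hher : ∀ (z : TorusSite 4 L) (b : Fin 3) (β : Fin 4), torusDist x z ≤ 64 * ⌈Real.sqrt s⌉₊ →
          Real.sqrt (∑ j, ‖(NormedSpace.exp (-((s / 8 : ℝ) : ℂ) • ((wilsonDirac (fundamentalRep (Fin 3)) U m 1)ᴴ *
            wilsonDirac (fundamentalRep (Fin 3)) U m 1))) (z, b, β) j‖ ^ 2) ≤ 8 * sSup (𝒜 S) / s := by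
        intro z b β hz
        have h2c := two_mul_ceil_sqrt_div_eight_le hs
        have hmem : (s / 8) * Real.sqrt (∑ j, ‖(NormedSpace.exp (-((s / 8 : ℝ) : ℂ) • ((wilsonDirac (fundamentalRep (Fin 3)) U m 1)ᴴ *
            wilsonDirac (fundamentalRep (Fin 3)) U m 1))) (z, b, β) j‖ ^ 2) ∈ 𝒜 S := by
          rw [h𝒜]
          refine ⟨L, hL, U, m, z, b, β, s / 8, hm, by linarith, by linarith, ?_, ?_, rfl⟩
          · have : ⌈Real.sqrt (s / 8)⌉₊ ≤ ⌈Real.sqrt s⌉₊ := Nat.ceil_mono (Real.sqrt_le_sqrt (by linarith))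
            omega
          · intro z' hz' μ
            have hxz' : torusDist x z' ≤ 128 * ⌈Real.sqrt s⌉₊ := by
              have := torusDist_triangle' x z z'
              omega
            have h := hflat z' hxz' μ
            have hs0 : 0 < s := by linarith
            have : 8 * κ ^ 2 / s ≤ 8 * κ ^ 2 / (s / 8) := by
              rw [div_le_div_iff₀ hs0 (by positivity)]; nlinarith [sq_nonneg κ]
            exact h.trans this
        have hlesup := le_csSup (hbdd S) hmem
        rw [le_div_iff₀ (by linarith : (0:ℝ) < s)]
        linarith
      have hmain := hMain hcr hCr hFR (abs_nonneg Cc) hComm' U hm x a α hκ0 (hsup0 S) hs hLs hflat hher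
      refine le_trans ?_ (le_max_right _ _)
      rw [hC₀, hC₁]
      linarith
  /- ───── the fixed point: `sSup (𝒜 S) ≤ Bstar` ───── -/
  have hfix : ∀ S, sSup (𝒜 S) ≤ Bstar := by
    intro S
    have hb := Real.sSup_le (hkey S) (le_trans (by norm_num) (le_max_left _ _))
    set b := sSup (𝒜 S) with hb_def
    have hb0 : 0 ≤ b := hsup0 S
    rcases le_max_iff.mp hb with h1 | h2
    · exact h1.trans (le_max_left _ _)
    · have : b ≤ C₀ + b / 2 := by nlinarith
      have : b ≤ 2 * C₀ := by linarith
      exact this.trans (le_max_right _ _)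
  -- consequence for every admissible datum
  have hrowbound : ∀ (L : ℕ) [NeZero L] (U : GaugeConfig 4 L SU3) (m : ℝ), m ∈ Set.Icc (-(1 / 2 : ℝ)) 1 →
      ∀ (x : TorusSite 4 L) (a : Fin 3) (α : Fin 4) (s : ℝ), 1 ≤ s → 1024 * ⌈Real.sqrt s⌉₊ ≤ L →
      (∀ z : TorusSite 4 L, torusDist x z ≤ 128 * ⌈Real.sqrt s⌉₊ → ∀ μ : Fin 4,
        3 - ((fundamentalRep (Fin 3)) (U (z, μ))).trace.re ≤ 8 * κ ^ 2 / s) →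
      ∑ j, ‖(NormedSpace.exp (-(s : ℂ) • ((wilsonDirac (fundamentalRep (Fin 3)) U m 1)ᴴ *
        wilsonDirac (fundamentalRep (Fin 3)) U m 1))) (x, a, α) j‖ ^ 2 ≤ (Bstar / s) ^ 2 := by
    intro L _ U m hm x a α s hs1 hLs hflat
    have hmem : s * Real.sqrt (∑ j, ‖(NormedSpace.exp (-(s : ℂ) • ((wilsonDirac (fundamentalRep (Fin 3)) U m 1)ᴴ *
        wilsonDirac (fundamentalRep (Fin 3)) U m 1))) (x, a, α) j‖ ^ 2) ∈ 𝒜 s := by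
      rw [h𝒜]; exact ⟨L, inferInstance, U, m, x, a, α, s, hm, hs1, le_rfl, hLs, hflat, rfl⟩
    have h1 := (le_csSup (hbdd s) hmem).trans (hfix s)
    have hs0 : 0 < s := by linarith
    have hsq : Real.sqrt (∑ j, ‖(NormedSpace.exp (-(s : ℂ) • ((wilsonDirac (fundamentalRep (Fin 3)) U m 1)ᴴ *
        wilsonDirac (fundamentalRep (Fin 3)) U m 1))) (x, a, α) j‖ ^ 2) ≤ Bstar / s := by
      rw [le_div_iff₀ hs0]; linarith
    have h0 : 0 ≤ ∑ j, ‖(NormedSpace.exp (-(s : ℂ) • ((wilsonDirac (fundamentalRep (Fin 3)) U m 1)ᴴ *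
        wilsonDirac (fundamentalRep (Fin 3)) U m 1))) (x, a, α) j‖ ^ 2 := Finset.sum_nonneg fun _ _ => by positivity
    calc _ = (Real.sqrt (∑ j, ‖(NormedSpace.exp (-(s : ℂ) • ((wilsonDirac (fundamentalRep (Fin 3)) U m 1)ᴴ *
        wilsonDirac (fundamentalRep (Fin 3)) U m 1))) (x, a, α) j‖ ^ 2)) ^ 2 := (Real.sq_sqrt h0).symm
      _ ≤ (Bstar / s) ^ 2 := pow_le_pow_left₀ (Real.sqrt_nonneg _) hsq 2
  /- ───── conversion to the registered `ℓ`-form ───── -/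
  refine ⟨κ, hκ0, 2 ^ 20 * max Bstar 1, ?_⟩
  intro L _ U m hm x ℓ hℓ hℓL hflatℓ s hs1 hsℓ a α
  set C : ℝ := 2 ^ 20 * max Bstar 1 with hC
  have hC1 : (2:ℝ) ^ 20 ≤ C := by
    have := le_max_right Bstar 1; nlinarith
  have hCB : (2:ℝ) ^ 20 * Bstar ≤ C := by
    have := le_max_left Bstar 1; nlinarith
  have hs0 : 0 < s := by linarith
  -- the trivial bound `rowSq ≤ 1`
  have htriv := rowSq_heat_le_one hContr (wilsonDirac (fundamentalRep (Fin 3)) U m 1) (x, a, α) hs0.le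
  -- admissibility at small times
  have hadm : ∀ s' : ℝ, 1 ≤ s' → s' ≤ (ℓ : ℝ) ^ 2 / 2 ^ 20 →
      1024 * ⌈Real.sqrt s'⌉₊ ≤ L ∧ (∀ z : TorusSite 4 L, torusDist x z ≤ 128 * ⌈Real.sqrt s'⌉₊ → ∀ μ : Fin 4,
        3 - ((fundamentalRep (Fin 3)) (U (z, μ))).trace.re ≤ 8 * κ ^ 2 / s') := by
    intro s' hs'1 hs'ℓ
    obtain ⟨hℓ1024, hA, hB⟩ := scales_of_small_time hs'1 hs'ℓ hℓL
    refine ⟨hA, fun z hz μ => ?_⟩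
    have h := (hflatℓ z (by omega)).1 μ
    refine h.trans ?_
    -- `(κ/ℓ)² ≤ 8κ²/s'` since `s' ≤ ℓ²/2²⁰ ≤ 8ℓ²`
    have hl : (0:ℝ) < ℓ := by exact_mod_cast (show 0 < ℓ by omega)
    rw [div_pow, div_le_div_iff₀ (by positivity) (by linarith)]
    nlinarith [sq_nonneg κ, sq_nonneg (ℓ:ℝ)]
  by_cases hsmall : s ≤ (ℓ : ℝ) ^ 2 / 2 ^ 20
  · obtain ⟨hA, hfl⟩ := hadm s hs1 hsmall
    have h := hrowbound L U m hm x a α s hs1 hA hfl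
    refine h.trans ?_
    gcongr
    have := le_max_left Bstar 1
    nlinarith
  · push Not at hsmall
    by_cases hbig : (2:ℝ) ^ 20 ≤ s
    · -- use the time `s' = s/2²⁰` and monotonicity
      have hs'1 : 1 ≤ s / 2 ^ 20 := by rw [le_div_iff₀ (by positivity)]; linarith
      have hs'ℓ : s / 2 ^ 20 ≤ (ℓ : ℝ) ^ 2 / 2 ^ 20 := by gcongr
      obtain ⟨hA, hfl⟩ := hadm (s / 2 ^ 20) hs'1 hs'ℓ
      have h := hrowbound L U m hm x a α (s / 2 ^ 20) hs'1 hA hfl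
      have hmono' := hMono _ (wilsonDirac (fundamentalRep (Fin 3)) U m 1) (x, a, α) (s / 2 ^ 20) s (by positivity)
        (by rw [div_le_iff₀ (by positivity)]; nlinarith)
      refine (hmono'.trans h).trans ?_
      rw [div_div_eq_mul_div]
      gcongr
      linarith
    · push Not at hbig
      refine htriv.trans ?_
      rw [one_le_sq_iff_one_le_abs, abs_of_nonneg (by positivity), le_div_iff₀ hs0]
      linarith

/-- **Stub S3 of the line (registered as `stub_caloricBootstrap`): `FreeKernelDecay → LocalSupBound`** — the
caloric sup-norm bootstrap, assembled from the landed main step, heat-row calculus, free row bounds and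
commutator bound. -/
theorem stub_caloricBootstrap :
    (∃ C c : ℝ, 0 < c ∧ ∀ (L : ℕ) [NeZero L] (m : ℝ), m ∈ Set.Icc (-(1 / 2 : ℝ)) 1 →
      ∀ σ : ℝ, 0 ≤ σ → σ ≤ (L : ℝ) ^ 2 →
      ∀ (x z : TorusSite 4 L) (a b : Fin 3) (α β : Fin 4),
        ‖(NormedSpace.exp (-(σ : ℂ) •
            ((wilsonDirac (fundamentalRep (Fin 3)) (freeCfg L) m 1)ᴴ *
              wilsonDirac (fundamentalRep (Fin 3)) (freeCfg L) m 1))) (x, a, α) (z, b, β)‖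
          ≤ C * Real.exp (-(c * σ * m ^ 2)) * (1 + σ) / (1 + σ + (torusDist x z : ℝ) ^ 2) ^ 3 ∧
        ∀ μ : Fin 4,
          ‖(NormedSpace.exp (-(σ : ℂ) •
              ((wilsonDirac (fundamentalRep (Fin 3)) (freeCfg L) m 1)ᴴ *
                wilsonDirac (fundamentalRep (Fin 3)) (freeCfg L) m 1))) (x, a, α) (z, b, β) -
            (NormedSpace.exp (-(σ : ℂ) •
              ((wilsonDirac (fundamentalRep (Fin 3)) (freeCfg L) m 1)ᴴ *
                wilsonDirac (fundamentalRep (Fin 3)) (freeCfg L) m 1))) (x, a, α) (Site.shift z μ, b, β)‖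
          ≤ C * Real.exp (-(c * σ * m ^ 2)) * Real.sqrt (1 + σ) / (1 + σ + (torusDist x z : ℝ) ^ 2) ^ 3) →
    (∃ κ : ℝ, 0 < κ ∧ ∃ C : ℝ, ∀ (L : ℕ) [NeZero L] (U : GaugeConfig 4 L SU3) (m : ℝ),
      m ∈ Set.Icc (-(1 / 2 : ℝ)) 1 → ∀ (x : TorusSite 4 L) (ℓ : ℕ), 1 ≤ ℓ → 4 * ℓ < L →
      (∀ z : TorusSite 4 L, torusDist x z ≤ 2 * ℓ →
        (∀ μ : Fin 4, 3 - ((fundamentalRep (Fin 3)) (U (z, μ))).trace.re ≤ (κ / (ℓ : ℝ)) ^ 2) ∧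
        (∀ μ ν : Fin 4, 3 - ((fundamentalRep (Fin 3)) (plaquetteHolonomy U z μ ν)).trace.re
          ≤ (κ / (ℓ : ℝ) ^ 2) ^ 2)) →
      ∀ s : ℝ, 1 ≤ s → s ≤ (ℓ : ℝ) ^ 2 → ∀ (a : Fin 3) (α : Fin 4),
        ∑ j, ‖(NormedSpace.exp (-(s : ℂ) •
            ((wilsonDirac (fundamentalRep (Fin 3)) U m 1)ᴴ * wilsonDirac (fundamentalRep (Fin 3)) U m 1)))
          (x, a, α) j‖ ^ 2 ≤ (C / s) ^ 2) :=
  fun hFree => caloric_core (@stub_mainStep) stub_heatRowCalculus (stub_freeRowBounds hFree) (stub_commutatorBound hFree)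

end Summit.QuantumFields.QCD.Cruxes.SmallFieldUltracontractivity.PointCentredAxialParabolic

end
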